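import Summits.ValiantsHypothesis.ValiantsHypothesis.Theorems.NewtonUnitEquationsTwoProductsMomentRecordDefs

/-!
# R13-coeff — TOWER RECORD LAW: data, records, the laws (typed text of val-idea-37 g4, transplanted by name)

Transplant (val-lit-p3 g18) of §1, §9 and the law statements of §10/§10b of val-idea-37 g4's kernel-checked scratch
`Cruxes/TwoProducts/TowerRecords_val_idea_37_g4.lean` (rev 3, sha16 988768bd6d8db99a; ns `ValIdea37g4T`; val-idea-crit-8 g2
VERDICT #19 + addendum: KEEP as the K11 `dvr-collapse-records` refinement «R13-coeff», by-name GO for a verbatim transplant).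
Statements only (`def … : Prop`), no proofs; the proofs follow in `…TowerRecord{Lemma,Cells,Count,Sparse,Levels}.lean`.
Helper text on crux `stmt-ValiantsHypothesis-5906` (`TwoProducts`, line `relation_ladder`); `--supports`, closes nothing.

MODEL.  Letters `x_i + e•d` (`0 ≤ e ≤ D`) — a TOWER of height `D` along one direction `d ∈ ℤ²` on each carrier `x_i`;
the letter pencils are arbitrary polynomials `γ_{j i} ∈ ℂ[z]` of degree `≤ D` (`[z^e] γ_{j i}` = coefficient of the letter `x_i + e d`
in factor `j`); `M(S) = Σ_j Π_i γ_{j i}^{S_i}` (`momentPolyT`), `L_k(S) = [z^k](M_u(S) − M_v(S))` (`layerT`), the pair `(S, k)` sits at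
`S•x + k•d` (the landed `MomentRecord.ptZ`).  `D = 1` is R12 (`MomentRecord.momentPoly`, `MomentRecord.layer`).  A RECORD for a real
weight `ξ` is a live shallow pair strictly heavier than every other (`IsRecordT`; ALL real `ξ` — no sign hypothesis).

LAWS typed here (all PROVED in the sequel files, std axioms):
* `TowerRecordLaw` — `#records ≤ 2^{a m}(t+2)^b (D+1)`, `(a,b) = (18,2)` (`…TowerRecordCount :: towerRecordLaw_holds`);
* `ThreeLevelRecordLaw` — levels `{0,1,H}`: `≤ 2^{23 m}(t+2)²` for EVERY height `H` (`…TowerRecordSparse :: threeLevelRecordLaw_holds`);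
* `SparseLevelRecordLaw ℓ` — `≤ ℓ` levels, any height: `a(ℓ) = 4ℓ²+10ℓ+16`, `b = 2` (`…TowerRecordLevels :: sparseLevelRecordLaw_holds`).
CLASS SIDE typed here (§9 of the source; the transfer is the p3 lineage's degree-`D` Lift, files `…TowerRecordLift*`):
`TowerDissociated`, `TowerCarrierLaw` (tail alphabet `⊆ X ⊔ (X+d) ⊔ … ⊔ (X+D•d)`, tower-dissociated ⇒ per-cell law `× (D+1)`),
`towerCarrier_of_towerRecord`; added at transplant (§9b, crit-8 g2 23:34:37Z remarks (2)(3)): `SparseLevelCarrierLaw ℓ` (class side of the sparse law,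
`ℓ` explicit, height-free), `sparseLevelCarrier_of_sparseLevelRecord ℓ`, `shiftedCarrier_of_towerCarrier` (R12 ⊆ R13 by name).

HONEST LABEL (crit-8 #19, binding): COEFFICIENT-SIDE laws; the class rung they feed (R13: dense PARALLEL towers of height `D` on dissociated
carriers) is a WIDER CLASS RUNG of the relation ladder, in 5906's currency while `D+1 ≤ 2^{O(m)}·poly t` (the sparse-level form is height-free for
a bounded number of levels), INERT AS A HATCH; the collinear digit towers of Disproof F10 are NOT covered; `ResidualLawV24` ⟺ `PlanarCellBound`,
the crux `…Theses.NewtonUnitEquations.TwoProducts` (stmt-5906), every `closes` binder and every summit statement are UNMOVED; VP ≠ VNP is NOT proved.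
Credit: statements and kernel proofs val-idea-37 g4; critic of record val-idea-crit-8 g2; R12 vocabulary (`size`, `wtZ`, `ptZ`, `shiftZ`) crit-8 g2
(✓ `…MomentRecordDefs`).  No instances, no notation, no named facts. [folklore]
-/

set_option linter.dupNamespace false

noncomputable section

open Classical

namespace Summit.ValiantsHypothesis.ValiantsHypothesis.Theorems.NewtonUnitEquations.TwoProducts.TowerRecord

open scoped BigOperators
open Polynomial
open Summit.ValiantsHypothesis.ValiantsHypothesis.Theorems.NewtonUnitEquations.TwoProducts.FormalLogLinearisation
open Summit.ValiantsHypothesis.ValiantsHypothesis.Theorems.NewtonUnitEquations.TwoProducts.MomentRecord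
open Summit.ValiantsHypothesis.ValiantsHypothesis.Theorems.NewtonUnitEquations.TwoProducts.PlanarCell

variable {m n : ℕ}

/-! ## 1. Tower data, records, the law -/

/-- Tower moment polynomial `Σ_j Π_i γ_{j i}^{S_i}` (pencils = arbitrary polynomials). -/
def momentPolyT (γ : Fin m → Fin n → ℂ[X]) (S : Fin n → ℕ) : ℂ[X] := ∑ j, ∏ i, γ j i ^ S i

/-- Layer `k` of the signed tower moment polynomial: `L_k(S) = [z^k](M_γ(S) − M_γ'(S))`. -/
def layerT (γ γ' : Fin m → Fin n → ℂ[X]) (k : ℕ) (S : Fin n → ℕ) : ℂ :=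
  (momentPolyT γ S - momentPolyT γ' S).coeff k

/-- All pencils have degree `≤ D` (towers of height `D`). -/
def DegLe (γ : Fin m → Fin n → ℂ[X]) (D : ℕ) : Prop := ∀ j i, (γ j i).natDegree ≤ D

/-- Live shallow pairs: `|S| ≤ m'` and `L_k(S) ≠ 0`. -/
def liveT (γ γ' : Fin m → Fin n → ℂ[X]) (m' : ℕ) : Set ((Fin n → ℕ) × ℕ) :=
  {p | size p.1 ≤ m' ∧ layerT γ γ' p.2 p.1 ≠ 0}

/-- `(S, k)` is a RECORD for `ξ`: live and strictly heavier than every other live shallow pair (ALL real weights `ξ`). -/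
def IsRecordT (γ γ' : Fin m → Fin n → ℂ[X]) (x : Fin n → Expo) (d : Fin 2 → ℤ) (m' : ℕ) (ξ : Fin 2 → ℝ)
    (p : (Fin n → ℕ) × ℕ) : Prop :=
  p ∈ liveT γ γ' m' ∧ ∀ q ∈ liveT γ γ' m', q ≠ p → wtZ ξ (ptZ x d q.1 q.2) < wtZ ξ (ptZ x d p.1 p.2)

/-- The finite box of shallow pairs of the tower model: entries of `S` at most `m'`, `k ≤ D m'`. -/
def shallowPairsT (n m' D : ℕ) : Finset ((Fin n → ℕ) × ℕ) :=
  (Fintype.piFinset fun _ : Fin n => Finset.range (m' + 1)) ×ˢ Finset.range (D * m' + 1)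

/-- **THE TOWER RECORD LAW** (val-idea-37 g4; R13-coeff): records of towers of height `D` number `≤ 2^{a m} (t+2)^b (D+1)`.
PROVED with `(a,b) = (18,2)` in `…TowerRecordCount :: towerRecordLaw_holds`. -/
def TowerRecordLaw : Prop :=
  ∃ a b : ℕ, ∀ (m n t D : ℕ) (γ γ' : Fin m → Fin n → ℂ[X]) (x : Fin n → Expo) (d : Fin 2 → ℤ),
    DegLe γ D → DegLe γ' D → n ≤ 2 * m * t →
    ((shallowPairsT n m D).filter fun p => ∃ ξ : Fin 2 → ℝ, IsRecordT γ γ' x d m ξ p).card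
      ≤ 2 ^ (a * m) * (t + 2) ^ b * (D + 1)

/-! ## 9. The class rung this law feeds (typed targets of the source; the transfer is the degree-`D` Lift, files `…TowerRecordLift*`) -/

/-- Tower dissociation to depth `(m, D)`: shallow pairs `|S| ≤ m`, `k ≤ D|S|` are separated by their planar point `S•x + k•d`
(PARALLEL towers on dissociated carriers; the collinear digit towers of F10 violate it maximally). -/
def TowerDissociated (x : Fin n → Expo) (d : Fin 2 → ℤ) (m D : ℕ) : Prop :=
  ∀ (S S' : Fin n → ℕ) (k k' : ℕ), size S ≤ m → size S' ≤ m → k ≤ D * size S → k' ≤ D * size S' →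
    ptZ x d S k = ptZ x d S' k' → (S = S' ∧ k = k')

/-- **(B_D) TOWER-CARRIER LAW** (the rung in the ladder's currency; typed target of the source): instances whose tail alphabet lies in
`X ⊔ (X+d) ⊔ … ⊔ (X+D•d)`, tower-dissociated to depth `(m, D)`, obey the per-cell law with an extra factor `(D+1)`.
`D = 1` is R12's `MomentRecord.ShiftedCarrierLaw` (up to `CarrierDissociated` vs `TowerDissociated … 1`).  HONEST LABEL: a wider CLASS rung
(dense parallel towers), inert as a hatch; not `PlanarCellBound`, not the crux. -/
def TowerCarrierLaw : Prop :=
  ∃ a b : ℕ, ∀ (m t n D : ℕ) (u v : Fin m → MvPolynomial (Fin 2) ℂ) (x : Fin n → Expo) (d : Fin 2 → ℤ),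
    2 ≤ t →
    (∀ j, MvPolynomial.coeff 0 (u j) = 0 ∧ (u j).support.card ≤ t) →
    (∀ j, MvPolynomial.coeff 0 (v j) = 0 ∧ (v j).support.card ≤ t) →
    (∀ e ∈ tailSupport u v, ∃ i : Fin n, ∃ j : ℕ, j ≤ D ∧ ∀ c, ((e c : ℕ) : ℤ) = ((x i c : ℕ) : ℤ) + (j : ℤ) * d c) →
    TowerDissociated x d m D →
    ∀ (R : Expo → Expo → Prop) (S : Finset Expo), IsCellFamily u v R S → S.card ≤ 2 ^ (a * m) * (t + 2) ^ b * (D + 1)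

/-- (A_D) ⇒ (B_D), M-sized (typed target of the source): the graded log-linearisation with pencils
`γ_{j i}(z) = Σ_{e ≤ D} [X^{x_i + e d}] u_j · z^e` identifies a visible point of a cell family with the planar point of a record `(S, k)`
(tower dissociation makes `(S,k) ↦ S•x + k•d` injective on live shallow pairs, `k ≤ D|S|` by `le_of_layerT_ne_zero`), exactly as in R12's
`MomentRecord.Lift` (degree `1`). -/
def towerCarrier_of_towerRecord : Prop := TowerRecordLaw → TowerCarrierLaw

/-! ## 10. Sparse levels (statements; val-idea-37 g4 rev 2/3, answer to crit-8 VERDICT #19 (ii)) -/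

/-- The pencils use only the levels in `E` (`supp γ_{j i} ⊆ E`). -/
def LevelsIn (γ : Fin m → Fin n → ℂ[X]) (E : Finset ℕ) : Prop := ∀ j i, (γ j i).support ⊆ E

/-- **THREE-LEVEL RECORD LAW** (levels `{0, 1, H}`, any height `H`): records number `≤ 2^{a m}(t+2)^b`, INDEPENDENT of `H`.
PROVED with `(a,b) = (23,2)` in `…TowerRecordSparse :: threeLevelRecordLaw_holds`. -/
def ThreeLevelRecordLaw : Prop :=
  ∃ a b : ℕ, ∀ (m n t H : ℕ) (γ γ' : Fin m → Fin n → ℂ[X]) (x : Fin n → Expo) (d : Fin 2 → ℤ),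
    LevelsIn γ {0, 1, H} → LevelsIn γ' {0, 1, H} → n ≤ 2 * m * t →
    ((shallowPairsT n m (H + 1)).filter fun p => ∃ ξ : Fin 2 → ℝ, IsRecordT γ γ' x d m ξ p).card
      ≤ 2 ^ (a * m) * (t + 2) ^ b

/-- **SPARSE-LEVEL RECORD LAW** (`≤ ℓ` levels): `#records ≤ 2^{a m}(t+2)^b` with `a = a(ℓ)`, independent of the height `D` (which is only the
box parameter).  PROVED for `1 ≤ ℓ` with `a(ℓ) = 4ℓ² + 10ℓ + 16`, `b = 2` in `…TowerRecordLevels :: sparseLevelRecordLaw_holds`. -/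
def SparseLevelRecordLaw (ℓ : ℕ) : Prop :=
  ∃ a b : ℕ, ∀ (m n t D : ℕ) (γ γ' : Fin m → Fin n → ℂ[X]) (x : Fin n → Expo) (d : Fin 2 → ℤ) (E : Finset ℕ),
    E.card ≤ ℓ → LevelsIn γ E → LevelsIn γ' E → DegLe γ D → DegLe γ' D → n ≤ 2 * m * t →
    ((shallowPairsT n m D).filter fun p => ∃ ξ : Fin 2 → ℝ, IsRecordT γ γ' x d m ξ p).card
      ≤ 2 ^ (a * m) * (t + 2) ^ b

/-! ## 9b. Class-side typed targets added at transplant (val-idea-crit-8 g2 23:34:37Z remarks (2)(3); proved in the Lift / composition files) -/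

/-- **SPARSE-LEVEL CARRIER LAW** (class side of `SparseLevelRecordLaw ℓ`, the level count `ℓ` EXPLICIT, HEIGHT-FREE): instances whose tail
alphabet lies in `⊔_{j ∈ E} (X + j•d)` for a level set `E` with `|E| ≤ ℓ` inside `[0, D]`, tower-dissociated to depth `(m, D)`, obey the per-cell
law `≤ 2^{a m}(t+2)^b` with `a, b` depending on `ℓ` only (`a = a(ℓ) = O(ℓ²)` from `sparseLevelRecordLaw_holds`) — the height `D` does NOT enter
the bound.  HONEST LABEL: in 5906's currency exactly for BOUNDEDLY MANY levels `ℓ ≤ C` (a later ladder hatch carries `ℓ ≤ C` like R11's `K ≤ C`);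
the `t`-level digit towers of F10 (`ℓ = t`) and collinear fibre lumping are NOT covered; a wider CLASS rung, inert as a hatch; not
`PlanarCellBound`, not the crux; VP ≠ VNP is NOT proved. -/
def SparseLevelCarrierLaw (ℓ : ℕ) : Prop :=
  ∃ a b : ℕ, ∀ (m t n D : ℕ) (u v : Fin m → MvPolynomial (Fin 2) ℂ) (x : Fin n → Expo) (d : Fin 2 → ℤ) (E : Finset ℕ),
    E.card ≤ ℓ → (∀ j ∈ E, j ≤ D) → 2 ≤ t →
    (∀ j, MvPolynomial.coeff 0 (u j) = 0 ∧ (u j).support.card ≤ t) →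
    (∀ j, MvPolynomial.coeff 0 (v j) = 0 ∧ (v j).support.card ≤ t) →
    (∀ e ∈ tailSupport u v, ∃ i : Fin n, ∃ j ∈ E, ∀ c, ((e c : ℕ) : ℤ) = ((x i c : ℕ) : ℤ) + (j : ℤ) * d c) →
    TowerDissociated x d m D →
    ∀ (R : Expo → Expo → Prop) (S : Finset Expo), IsCellFamily u v R S → S.card ≤ 2 ^ (a * m) * (t + 2) ^ b

/-- (A_E) ⇒ (B_E): the same degree-`D` Lift with pencils supported on `E` (typed target; proved in `…TowerRecordLiftRecord`). -/
def sparseLevelCarrier_of_sparseLevelRecord (ℓ : ℕ) : Prop := SparseLevelRecordLaw ℓ → SparseLevelCarrierLaw ℓ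

/-- R12 ⊆ R13 BY NAME (typed target; proved in the composition file): at `D = 1` the alphabet clause of `TowerCarrierLaw` is R12's
`e = x_i ∨ e = x_i + d`, `TowerDissociated x d m 1 ↔ MomentRecord.CarrierDissociated x d m`, and the factor `(D+1) = 2 ≤ t+2` is absorbed
into `b + 1`; hence `TowerCarrierLaw → MomentRecord.ShiftedCarrierLaw`. -/
def shiftedCarrier_of_towerCarrier : Prop := TowerCarrierLaw → ShiftedCarrierLaw

end Summit.ValiantsHypothesis.ValiantsHypothesis.Theorems.NewtonUnitEquations.TwoProducts.TowerRecord

end
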